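import Summits.AtomisticToContinuum.BoseEinsteinCondensation.Theses.BECDyadicChaining

/-!
# Route `BECDyadicChaining` — support item `ZeroModeOfChaining` (stmt-AtomisticToContinuum-14112)

Closes stmt-AtomisticToContinuum-14112, the exact signature of
`Summit.AtomisticToContinuum.BoseEinsteinCondensation.Theses.BECDyadicChaining.ZeroModeOfChaining`:
the GLUE `DyadicCoherenceDefect → BaseCoherentMass → ZeroModeOccupation` of the route, i.e. the
telescoping chain that carries the two ranked cruxes to the shared zero-mode target X_B1
(stmt-AtomisticToContinuum-0686): every `δ`-near-minimiser `Ψ` of the Dirichlet energy in the box of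
side `L = (N/ρ)^{1/3}` has `⟨φ₀, γ_Ψ φ₀⟩ ≥ N/16` for the flat mode `φ₀ = L^{-3/2}·1_{box L}`.

Proof (the body of the route's proved deciding theorem `closes` after its first step
`bec_of_zeroMode`, [LSSY2005, §1.2] for the objects; the argument is elementary bookkeeping).
Fix `v`; take `ℓ_d, ρ₀′, β` from `DyadicCoherenceDefect` and `ρ₀″, ℓ_b ≥ ℓ_d, K` from
`BaseCoherentMass` fed this `ℓ_d`; `ρ₀ = min`, `δ = min(δ′, δ″)`, `c = 1/16`. For a `δ`-near-minimiser
every level `m ≤ K` has cube side `L/2^m ≥ ℓ_b ≥ ℓ_d`, so each `m ≤ K` has a dyadic bracket `j(m)`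
(`exists_nat_pow_near`) with `2^{j(m)+m} ≤ L/ℓ_d < 2^{j(m)+m+1}`; hence `j(m) + m` is constant and
`j` is injective on `{1,…,K}`. Telescoping the per-level inequalities `A_m ≤ A_{m-1} + β_{j(m)} √N`
gives `A_K ≤ A_0 + (Σ_{m ≤ K} β_{j(m)}) √N ≤ A_0 + √N/4` (`Finset.sum_image`, `Summable.sum_le_tsum`),
and `√N ≤ 2 A_K` gives `√N ≤ 4 A_0` in `ℝ≥0∞` (`√N < ∞`). `A_0` is the single level-0 term, whose cube
`{x | ∀ k, x_k ∈ (0·L, 1·L)}` is `box L` with weight `(√(L³))⁻¹`, so squaring yields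
`ofReal (N/16) ≤ ⟨φ₀, γ_Ψ φ₀⟩`.

No new definitions; everything is over `Literature.MathematicalPhysics.QuantumManyBody.BoseGas`
(`occupation`, `TrialState`, `energy`, `groundStateEnergy`, `sideLength`, `box`).
-/

namespace Summit.AtomisticToContinuum.BoseEinsteinCondensation.Theorems

open Summit.AtomisticToContinuum.BoseEinsteinCondensation.Theses.BECDyadicChaining

/-- Settles `stmt-AtomisticToContinuum-14112` (exact signature): the glue
`DyadicCoherenceDefect → BaseCoherentMass → ZeroModeOccupation` of route `BECDyadicChaining`, with
`ρ₀ = min`, `δ = min`, `c = 1/16`: dyadic brackets via `exists_nat_pow_near`, telescoping over the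
levels `1..K`, budget `Σ β ≤ 1/4` via `Finset.sum_image` + `Summable.sum_le_tsum`, then
`√N ≤ 2 A_K ≤ 2 A_0 + √N/2` and squaring in `ℝ≥0∞` (Lieb–Seiringer–Solovej–Yngvason 2005 §1.2 for the
objects; the argument is elementary bookkeeping). [folklore] -/
theorem zeroModeOfChaining_proof :
    Summit.AtomisticToContinuum.BoseEinsteinCondensation.Theses.BECDyadicChaining.ZeroModeOfChaining := by
  unfold Summit.AtomisticToContinuum.BoseEinsteinCondensation.Theses.BECDyadicChaining.ZeroModeOfChaining
    Summit.AtomisticToContinuum.BoseEinsteinCondensation.Theses.BECDyadicChaining.ZeroModeOccupation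
  intro hD hB
  classical
  intro v hv
  obtain ⟨ℓd, hℓd, ρ₁, hρ₁, H1⟩ := hD v hv
  obtain ⟨ρ₂, hρ₂, H2⟩ := hB v hv ℓd hℓd
  refine ⟨min ρ₁ ρ₂, lt_min hρ₁ hρ₂, fun ρ hρ hρlt => ?_⟩
  obtain ⟨β, hβ0, hβs, hβ4, E1⟩ := H1 ρ hρ (hρlt.trans_le (min_le_left _ _))
  obtain ⟨ℓb, hℓdb, E2⟩ := H2 ρ hρ (hρlt.trans_le (min_le_right _ _))
  refine ⟨1 / 16, by norm_num, ?_⟩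
  filter_upwards [E1, E2] with N hN1 hN2
  obtain ⟨δ₁, hδ₁, HΨ1⟩ := hN1
  obtain ⟨K, hK1, hK2, δ₂, hδ₂, HΨ2⟩ := hN2
  clear E1 E2 H1 H2
  have hLnn : 0 ≤ Literature.MathematicalPhysics.QuantumManyBody.BoseGas.sideLength ρ N :=
    Real.rpow_nonneg (div_nonneg (Nat.cast_nonneg _) hρ.le) _
  -- name the box side L (no local variable depends on it yet)
  generalize hLdef : Literature.MathematicalPhysics.QuantumManyBody.BoseGas.sideLength ρ N = L at HΨ1 HΨ2 hK1 hK2 hLnn ⊢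
  refine ⟨min δ₁ δ₂, lt_min hδ₁ hδ₂, fun Ψ hΨ => ?_⟩
  have h1 := HΨ1 Ψ (hΨ.trans (add_le_add le_rfl (min_le_left _ _)))
  have h2 := HΨ2 Ψ (hΨ.trans (add_le_add le_rfl (min_le_right _ _)))
  clear HΨ1 HΨ2
  -- abbreviations: block modes, coherent amplitudes, √N
  set φf : (m : ℕ) → (Fin 3 → Fin (2 ^ m)) → EuclideanSpace ℝ (Fin 3) → ℂ := fun m i =>
    Set.indicator {x : EuclideanSpace ℝ (Fin 3) | ∀ k : Fin 3, x k ∈ Set.Ioo (((i k : ℕ) : ℝ) * (L / 2 ^ m))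
      ((((i k : ℕ) : ℝ) + 1) * (L / 2 ^ m))} (fun _ => ((Real.sqrt ((L / 2 ^ m) ^ 3))⁻¹ : ℂ)) with hφf
  set A : ℕ → ENNReal := fun m => (8 : ENNReal) ^ (-(m : ℝ) / 2) *
    ∑ i : Fin 3 → Fin (2 ^ m), (Literature.MathematicalPhysics.QuantumManyBody.BoseGas.occupation N (φf m i) Ψ.ψ) ^ (1 / 2 : ℝ) with hA
  set S : ENNReal := (N : ENNReal) ^ (1 / 2 : ℝ) with hS
  have hSfin : S ≠ ⊤ := ENNReal.rpow_ne_top_of_nonneg (by norm_num) (ENNReal.natCast_ne_top N)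
  have h2top : (2 : ENNReal) ≠ ⊤ := ENNReal.ofNat_ne_top
  -- elementary facts about the scales
  have hscale : ∀ m, m ≤ K → ℓd ≤ L / 2 ^ m := by
    intro m hm
    calc ℓd ≤ ℓb := hℓdb
      _ ≤ L / 2 ^ K := hK1
      _ ≤ L / 2 ^ m := div_le_div_of_nonneg_left hLnn (pow_pos two_pos m) (pow_le_pow_right₀ one_le_two hm)
  -- the dyadic bracket j(m) of every level m ≤ K
  have hbr : ∀ m, m ≤ K → ∃ j : ℕ, ℓd * 2 ^ j ≤ L / 2 ^ m ∧ L / 2 ^ m < ℓd * 2 ^ (j + 1) := by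
    intro m hm
    have hx : 1 ≤ L / 2 ^ m / ℓd := by
      rw [le_div_iff₀ hℓd, one_mul]; exact hscale m hm
    obtain ⟨j, hj1, hj2⟩ := exists_nat_pow_near hx one_lt_two
    refine ⟨j, ?_, ?_⟩
    · have := (le_div_iff₀ hℓd).mp hj1
      linarith [mul_comm ((2 : ℝ) ^ j) ℓd]
    · have := (div_lt_iff₀ hℓd).mp hj2
      linarith [mul_comm ((2 : ℝ) ^ (j + 1)) ℓd]
  choose! jf hjf1 hjf2 using hbr
  -- j(m) + m is constant in m, hence j is injective on the levels ≤ K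
  have hup : ∀ m, m ≤ K → (2 : ℝ) ^ (jf m + m) ≤ L / ℓd := by
    intro m hm
    rw [le_div_iff₀ hℓd]
    have := (le_div_iff₀ (pow_pos two_pos m)).mp (hjf1 m hm)
    calc (2 : ℝ) ^ (jf m + m) * ℓd = ℓd * 2 ^ jf m * 2 ^ m := by rw [pow_add]; ring
      _ ≤ L := this
  have hlow : ∀ m, m ≤ K → L / ℓd < (2 : ℝ) ^ (jf m + m + 1) := by
    intro m hm
    rw [div_lt_iff₀ hℓd]
    have := (div_lt_iff₀ (pow_pos two_pos m)).mp (hjf2 m hm)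
    calc L < ℓd * 2 ^ (jf m + 1) * 2 ^ m := this
      _ = (2 : ℝ) ^ (jf m + m + 1) * ℓd := by rw [pow_add, pow_add, pow_add]; ring
  have hle : ∀ m m', m ≤ K → m' ≤ K → jf m + m ≤ jf m' + m' := by
    intro m m' hm hm'
    by_contra hcon
    have hcon' : jf m' + m' + 1 ≤ jf m + m := by omega
    have h3 : (2 : ℝ) ^ (jf m' + m' + 1) ≤ 2 ^ (jf m + m) := pow_le_pow_right₀ one_le_two hcon'
    exact absurd ((hup m hm).trans_lt (hlow m' hm')) (not_lt.mpr h3)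
  have hinj : ∀ m ∈ Finset.Icc 1 K, ∀ m' ∈ Finset.Icc 1 K, jf m = jf m' → m = m' := by
    intro m hm m' hm' hjj
    rw [Finset.mem_Icc] at hm hm'
    have e1 := hle m m' hm.2 hm'.2
    have e2 := hle m' m hm'.2 hm.2
    omega
  -- the budget spent on the levels 1..K is at most Σ β ≤ 1/4
  have hsumβ : ∑ m ∈ Finset.Icc 1 K, β (jf m) ≤ 1 / 4 := by
    rw [← Finset.sum_image hinj]
    exact (hβs.sum_le_tsum _ (fun j _ => hβ0 j)).trans hβ4
  -- abstract telescoping in ℝ≥0∞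
  have tele : ∀ (A : ℕ → ENNReal) (b : ℕ → ENNReal) (S : ENNReal) (K : ℕ),
      (∀ m, 1 ≤ m → m ≤ K → A m ≤ A (m - 1) + b m * S) →
      A K ≤ A 0 + (∑ m ∈ Finset.Icc 1 K, b m) * S := by
    intro A b S K h
    induction K with
    | zero => simp
    | succ K ih =>
      have ih' := ih (fun m hm hmK => h m hm (hmK.trans (Nat.le_succ K)))
      calc A (K + 1) ≤ A (K + 1 - 1) + b (K + 1) * S := h (K + 1) (Nat.succ_pos K) le_rfl
        _ = A K + b (K + 1) * S := by rw [Nat.add_sub_cancel]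
        _ ≤ (A 0 + (∑ m ∈ Finset.Icc 1 K, b m) * S) + b (K + 1) * S := add_le_add ih' le_rfl
        _ = A 0 + (∑ m ∈ Finset.Icc 1 (K + 1), b m) * S := by
          rw [Finset.sum_Icc_succ_top (Nat.succ_le_succ (Nat.zero_le K)), add_mul, add_assoc]
  -- the per-level inequalities of DyadicCoherenceDefect along the brackets
  have hstep : ∀ m, 1 ≤ m → m ≤ K → A m ≤ A (m - 1) + ENNReal.ofReal (β (jf m)) * S :=
    fun m hm hmK => h1 m (jf m) hm (hjf1 m hmK) (hjf2 m hmK)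
  have hK : A K ≤ A 0 + (∑ m ∈ Finset.Icc 1 K, ENNReal.ofReal (β (jf m))) * S :=
    tele A (fun m => ENNReal.ofReal (β (jf m))) S K hstep
  have hsum' : (∑ m ∈ Finset.Icc 1 K, ENNReal.ofReal (β (jf m))) ≤ ENNReal.ofReal (1 / 4) := by
    rw [← ENNReal.ofReal_sum_of_nonneg (fun m _ => hβ0 (jf m))]
    exact ENNReal.ofReal_le_ofReal hsumβ
  have hquarter : ENNReal.ofReal (1 / 4) = 4⁻¹ := by
    rw [one_div, ENNReal.ofReal_inv_of_pos (by norm_num : (0 : ℝ) < 4), ENNReal.ofReal_ofNat]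
  have htwo : (2 : ENNReal) * 4⁻¹ = 2⁻¹ := by
    have h4 : (4 : ENNReal) = 2 * 2 := by norm_num
    rw [h4, ENNReal.mul_inv (Or.inl two_ne_zero) (Or.inl h2top), ← mul_assoc,
      ENNReal.mul_inv_cancel two_ne_zero h2top, one_mul]
  -- BaseCoherentMass: √N ≤ 2 A_K; telescoping: A_K ≤ A_0 + √N/4
  have h2' : S ≤ 2 * A K := h2
  have hK' : A K ≤ A 0 + 4⁻¹ * S :=
    hK.trans (add_le_add le_rfl (hquarter ▸ mul_le_mul' hsum' le_rfl))
  have hmain : S ≤ 2 * A 0 + 2⁻¹ * S := by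
    calc S ≤ 2 * A K := h2'
      _ ≤ 2 * (A 0 + 4⁻¹ * S) := mul_le_mul' le_rfl hK'
      _ = 2 * A 0 + 2⁻¹ * S := by rw [mul_add, ← mul_assoc (2 : ENNReal) 4⁻¹ S, htwo]
  have hhalf : 2⁻¹ * S + 2⁻¹ * S = S := by
    rw [← two_mul, ← mul_assoc, ENNReal.mul_inv_cancel two_ne_zero h2top, one_mul]
  have hS2 : 2⁻¹ * S ≤ 2 * A 0 := by
    have : 2⁻¹ * S + 2⁻¹ * S ≤ 2 * A 0 + 2⁻¹ * S := by rw [hhalf]; exact hmain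
    exact (ENNReal.add_le_add_iff_right (ENNReal.mul_ne_top (ENNReal.inv_ne_top.mpr two_ne_zero) hSfin)).mp this
  have hS4 : S ≤ 4 * A 0 := by
    calc S = 2 * (2⁻¹ * S) := by
          rw [← mul_assoc, ENNReal.mul_inv_cancel two_ne_zero h2top, one_mul]
      _ ≤ 2 * (2 * A 0) := mul_le_mul' le_rfl hS2
      _ = 4 * A 0 := by rw [← mul_assoc]; norm_num
  -- level 0 is the single cube (0,L)³ with the normalised constant mode
  obtain ⟨i₀, hi₀⟩ : ∃ i₀ : Fin 3 → Fin (2 ^ 0), ∀ k, ((i₀ k : ℕ) : ℝ) = 0 :=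
    ⟨fun _ => ⟨0, by norm_num⟩, fun _ => by simp⟩
  have hsub : Subsingleton (Fin 3 → Fin (2 ^ 0)) := by rw [pow_zero]; infer_instance
  have hA0 : A 0 = (Literature.MathematicalPhysics.QuantumManyBody.BoseGas.occupation N (φf 0 i₀) Ψ.ψ) ^ (1 / 2 : ℝ) := by
    have e1 : A 0 = (8 : ENNReal) ^ (-((0 : ℕ) : ℝ) / 2) *
        ∑ i : Fin 3 → Fin (2 ^ 0), (Literature.MathematicalPhysics.QuantumManyBody.BoseGas.occupation N (φf 0 i) Ψ.ψ) ^ (1 / 2 : ℝ) := rfl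
    rw [e1, Fintype.sum_subsingleton _ i₀]
    simp only [Nat.cast_zero, neg_zero, zero_div, ENNReal.rpow_zero, one_mul]
  have hφ0 : φf 0 i₀ = (Literature.MathematicalPhysics.QuantumManyBody.BoseGas.box L).indicator
      (fun _ => ((Real.sqrt (L ^ 3))⁻¹ : ℂ)) := by
    have hset : {x : EuclideanSpace ℝ (Fin 3) | ∀ k : Fin 3, x k ∈ Set.Ioo (((i₀ k : ℕ) : ℝ) * (L / 2 ^ 0))
        ((((i₀ k : ℕ) : ℝ) + 1) * (L / 2 ^ 0))} = Literature.MathematicalPhysics.QuantumManyBody.BoseGas.box L := by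
      ext x
      simp [Literature.MathematicalPhysics.QuantumManyBody.BoseGas.box]
    have hnorm : ((Real.sqrt ((L / 2 ^ 0) ^ 3))⁻¹ : ℂ) = ((Real.sqrt (L ^ 3))⁻¹ : ℂ) := by
      rw [pow_zero, div_one]
    show Set.indicator {x : EuclideanSpace ℝ (Fin 3) | ∀ k : Fin 3, x k ∈ Set.Ioo (((i₀ k : ℕ) : ℝ) * (L / 2 ^ 0))
        ((((i₀ k : ℕ) : ℝ) + 1) * (L / 2 ^ 0))} (fun _ => ((Real.sqrt ((L / 2 ^ 0) ^ 3))⁻¹ : ℂ)) = _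
    rw [hset, hnorm]
  -- conclusion: N ≤ 16 · occupation of the constant mode
  set occ₀ := Literature.MathematicalPhysics.QuantumManyBody.BoseGas.occupation N
    ((Literature.MathematicalPhysics.QuantumManyBody.BoseGas.box L).indicator (fun _ => ((Real.sqrt (L ^ 3))⁻¹ : ℂ))) Ψ.ψ with hocc₀
  have hroot : S ≤ 4 * occ₀ ^ (1 / 2 : ℝ) := by rw [hocc₀, ← hφ0, ← hA0]; exact hS4
  have hN16 : (N : ENNReal) ≤ 16 * occ₀ := by
    have hsq := ENNReal.rpow_le_rpow hroot (by norm_num : (0 : ℝ) ≤ 2)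
    have eS : S ^ (2 : ℝ) = (N : ENNReal) := by
      rw [hS, ← ENNReal.rpow_mul]; norm_num
    have eR : (4 * occ₀ ^ (1 / 2 : ℝ)) ^ (2 : ℝ) = 16 * occ₀ := by
      rw [ENNReal.mul_rpow_of_nonneg _ _ (by norm_num : (0 : ℝ) ≤ 2), ← ENNReal.rpow_mul]
      have h16 : (4 : ENNReal) ^ (2 : ℝ) = 16 := by
        rw [show (2 : ℝ) = ((2 : ℕ) : ℝ) by norm_num, ENNReal.rpow_natCast]; norm_num
      rw [h16]; norm_num
    rwa [eS, eR] at hsq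
  calc ENNReal.ofReal (1 / 16 * (N : ℝ)) = 16⁻¹ * (N : ENNReal) := by
        rw [ENNReal.ofReal_mul (by norm_num), ENNReal.ofReal_natCast, one_div,
          ENNReal.ofReal_inv_of_pos (by norm_num : (0 : ℝ) < 16), ENNReal.ofReal_ofNat]
    _ ≤ 16⁻¹ * (16 * occ₀) := mul_le_mul' le_rfl hN16
    _ = occ₀ := by
        rw [← mul_assoc, ENNReal.inv_mul_cancel (by norm_num) (by norm_num), one_mul]

end Summit.AtomisticToContinuum.BoseEinsteinCondensation.Theorems
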